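import Literature.NumberTheory.Automorphic.ShimuraCurveCartanLevel
import HarnessLib

/-!
# Crux NUM `CartanOnePlaceDegreeLawAtThree` (RULING 113; routes `ClassRecordThree` ∕ `KolyvaginRoadThree`), analytic dictionary D1 —
# the COVER ORDER `O₀' = X.O + (∏_{C∖q} p)·X.O₀` and the PRINCIPAL LEVEL-`q` GROUP `Γ̄(q) ⊴ ι(O₀'¹)` of a Cartan datum at a Cartan place `q`

Seat `bsd-stepL-tam3-p1` g26 (LEAD of 19109 ∕ 23422; `--supports` the residue crux 23422). First slice of the Jacobian-free typing D1 of the node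
(F2b♮) ⟺ NUM (`HOME/tam3-p1/g26/NUM-LINES-AND-D1-DESIGN-g26.md` §4; bsd-idea-10 g16 `Cruxes/EulerHalvesAtThree/D1-ANALYTIC-DICTIONARY.md` row M0):
for `X : CartanLevelCurveData D M C` and a place `q`, the order `coverOrder X q := X.O ⊔ (∏_{p ∈ C∖q} p)•X.O₀` (it is `X.O` away from `q` and the Eichler
order `X.O₀` — maximal at `q ∤ D M` — at `q`), its norm-one group `coverUnits X q = ι(O₀'¹)`, and the principal level-`q` subgroup
`principalLevel X q = {ι(x) : x ∈ O₀'¹, x ≡ 1 (mod q O₀')}`. PROVED (elementary): `coverOrder` is an order between `X.O` and `X.O₀`; `principalLevel ≤ X.Gamma ≤ coverUnits`;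
`principalLevel` is NORMAL in `coverUnits` (so `coverUnits` acts on `S₂(principalLevel)` by slash, and the action on `X.Gamma`-forms factors through the finite
quotient); `-1 ∈ coverUnits`. NOT here (next slices): the reduction `O₀' ↠ M₂(𝔽_q)` with kernel `q O₀'` and `coverUnits ∕ principalLevel ≅ SL₂(𝔽_q)` (strong
approximation, print), the induced module `Ind_{SL₂(𝔽_q)}^{GL₂(𝔽_q)} S₂(Γ̄)` (the disconnected full-level-`q` cover, `π₀ ≅ 𝔽_q^×`), the period lattice `𝕃`.
Definitions + elementary lemmas only; nothing about degrees, `Ш` or any curve; BSD is proved for no curve.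
[cite: KohenPacetti2016, §2 (the groups Γ_ns^ε(N) ∩ Γ₀(m), arXiv:1403.7801v3 pp. 7–8)] [cite: VignerasLNM800, Ch. IV §1]
-/

set_option linter.dupNamespace false
set_option autoImplicit false

noncomputable section

open scoped Classical Pointwise MatrixGroups ModularForm

namespace Summit.BirchSwinnertonDyer.BirchSwinnertonDyer.Theorems.CartanCover

open Literature.NumberTheory.Automorphic

variable {D M : ℕ} {C : Finset ℕ}

/-! ## §1 The cover order `O₀' = X.O + (∏_{C∖q} p) • X.O₀` -/

/-- The integer `n_q := ∏_{p ∈ C∖q} p` (the Cartan places other than `q`). -/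
def coverIndex (C : Finset ℕ) (q : ℕ) : ℕ := ∏ p ∈ C.erase q, p

/-- **The cover order** `O₀' := X.O + n_q • X.O₀`: equal to `X.O` locally away from `q` and to the Eichler order `X.O₀` (maximal at `q`) locally at `q`.
[cite: KohenPacetti2016, §2 (arXiv:1403.7801v3 pp. 7–8)] -/
def coverOrder (X : CartanLevelCurveData D M C) (q : ℕ) : Submodule ℤ X.B :=
  X.O ⊔ X.O₀.map (((coverIndex C q : ℕ) : ℤ) • LinearMap.id)

/-- `X.O ⊆ O₀'`. -/
theorem le_coverOrder (X : CartanLevelCurveData D M C) (q : ℕ) : X.O ≤ coverOrder X q := le_sup_left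

/-- Membership in `O₀'`: `x = a + n_q • y` with `a ∈ X.O`, `y ∈ X.O₀`. -/
theorem mem_coverOrder_iff (X : CartanLevelCurveData D M C) (q : ℕ) {x : X.B} :
    x ∈ coverOrder X q ↔ ∃ a ∈ X.O, ∃ y ∈ X.O₀, x = a + ((coverIndex C q : ℕ) : ℤ) • y := by
  unfold coverOrder
  rw [Submodule.mem_sup]
  constructor
  · rintro ⟨a, ha, z, hz, rfl⟩
    rw [Submodule.mem_map] at hz
    obtain ⟨y, hy, rfl⟩ := hz
    exact ⟨a, ha, y, hy, by simp⟩
  · rintro ⟨a, ha, y, hy, rfl⟩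
    exact ⟨a, ha, ((coverIndex C q : ℕ) : ℤ) • y, Submodule.mem_map.mpr ⟨y, hy, by simp⟩, rfl⟩

/-- `n_q • X.O₀ ⊆ O₀'`. -/
theorem smul_mem_coverOrder (X : CartanLevelCurveData D M C) (q : ℕ) {y : X.B} (hy : y ∈ X.O₀) : ((coverIndex C q : ℕ) : ℤ) • y ∈ coverOrder X q :=
  (mem_coverOrder_iff X q).mpr ⟨0, X.O.zero_mem, y, hy, by simp⟩

/-- `O₀' ⊆ X.O₀`. -/
theorem coverOrder_le (X : CartanLevelCurveData D M C) (q : ℕ) : coverOrder X q ≤ X.O₀ := by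
  intro x hx
  obtain ⟨a, ha, y, hy, rfl⟩ := (mem_coverOrder_iff X q).mp hx
  exact X.O₀.add_mem (X.le ha) (X.O₀.smul_mem _ hy)

/-- `q • O₀' ⊆ X.O` when `q ∈ C` (as `q · n_q = ∏_C p` and `(∏_C p) • X.O₀ ⊆ X.O`). -/
theorem smul_mem_O_of_mem_coverOrder (X : CartanLevelCurveData D M C) (q : ℕ) (hq : q ∈ C) {x : X.B} (hx : x ∈ coverOrder X q) : (q : ℤ) • x ∈ X.O := by
  obtain ⟨a, ha, y, hy, rfl⟩ := (mem_coverOrder_iff X q).mp hx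
  rw [smul_add, smul_smul]
  refine X.O.add_mem (X.O.smul_mem _ ha) ?_
  have hprod : ((q : ℤ) * ((coverIndex C q : ℕ) : ℤ)) = ((∏ p ∈ C, p : ℕ) : ℤ) := by
    unfold coverIndex
    rw [← Finset.mul_prod_erase C (fun p => p) hq]
    push_cast
    ring
  rw [hprod]
  exact X.smul_mem y hy

/-- The cover order is an order. -/
theorem isOrder_coverOrder (X : CartanLevelCurveData D M C) (q : ℕ) : Brandt.IsOrder X.B (coverOrder X q) where
  one_mem := le_coverOrder X q X.isOrder.one_mem
  mul_mem := by
    intro a ha b hb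
    obtain ⟨a₁, ha₁, y₁, hy₁, rfl⟩ := (mem_coverOrder_iff X q).mp ha
    obtain ⟨b₁, hb₁, y₂, hy₂, rfl⟩ := (mem_coverOrder_iff X q).mp hb
    have hO₀ := X.isEichlerOrder.isOrder
    set n : ℤ := ((coverIndex C q : ℕ) : ℤ) with hn
    have e : (a₁ + n • y₁) * (b₁ + n • y₂) = a₁ * b₁ + n • (a₁ * y₂ + y₁ * b₁ + n • (y₁ * y₂)) := by
      simp only [mul_add, add_mul, smul_mul_assoc, mul_smul_comm, smul_add, smul_smul]
      abel
    rw [e]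
    refine (coverOrder X q).add_mem (le_coverOrder X q (X.isOrder.mul_mem a₁ ha₁ b₁ hb₁)) (smul_mem_coverOrder X q ?_)
    refine X.O₀.add_mem (X.O₀.add_mem ?_ ?_) (X.O₀.smul_mem _ (hO₀.mul_mem y₁ hy₁ y₂ hy₂))
    · exact hO₀.mul_mem a₁ (X.le ha₁) y₂ hy₂
    · exact hO₀.mul_mem y₁ hy₁ b₁ (X.le hb₁)
  isFullLattice := by
    refine ⟨?_, fun d => ?_⟩
    · exact Submodule.FG.sup X.isOrder.isFullLattice.1 (Submodule.FG.map _ X.isEichlerOrder.isOrder.isFullLattice.1)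
    · obtain ⟨n, hn, hnd⟩ := X.isOrder.isFullLattice.2 d
      exact ⟨n, hn, le_coverOrder X q hnd⟩

/-! ## §2 The groups `Γ̄(q) ≤ X.Gamma ≤ ι(O₀'¹)` -/

/-- **`ι(O₀'¹)`**, the norm-one group of the cover order (the level-prime-to-`q` group over `X`). [cite: VignerasLNM800, Ch. IV §1] -/
def coverUnits (X : CartanLevelCurveData D M C) (q : ℕ) : Subgroup (GL (Fin 2) ℝ) := normOneUnits X.ι (isOrder_coverOrder X q)

/-- `X.Gamma = ι(X.O¹) ≤ ι(O₀'¹)`. -/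
theorem Gamma_le_coverUnits (X : CartanLevelCurveData D M C) (q : ℕ) : X.Gamma ≤ coverUnits X q := by
  rintro g ⟨⟨x, hx, hxg⟩, ⟨y, hy, hyg⟩, hdet⟩
  exact ⟨⟨x, le_coverOrder X q hx, hxg⟩, ⟨y, le_coverOrder X q hy, hyg⟩, hdet⟩

/-- `-1 ∈ ι(O₀'¹)`. -/
theorem neg_one_mem_coverUnits (X : CartanLevelCurveData D M C) (q : ℕ) : -1 ∈ coverUnits X q := neg_one_mem_normOneUnits X.ι (isOrder_coverOrder X q)

/-- An element of `B` whose image under the (injective) real splitting is the matrix of `g ∈ ι(O₀'¹)`, and its inverse partner. -/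
theorem exists_mul_eq_one_of_mem_coverUnits (X : CartanLevelCurveData D M C) (q : ℕ) {g : GL (Fin 2) ℝ} (hg : g ∈ coverUnits X q) :
    ∃ x ∈ coverOrder X q, ∃ z ∈ coverOrder X q, X.ι x = (g : Matrix (Fin 2) (Fin 2) ℝ) ∧
      X.ι z = ((g⁻¹ : GL (Fin 2) ℝ) : Matrix (Fin 2) (Fin 2) ℝ) ∧ x * z = 1 ∧ z * x = 1 := by
  obtain ⟨⟨x, hx, hxg⟩, ⟨z, hz, hzg⟩, -⟩ := hg
  refine ⟨x, hx, z, hz, hxg, hzg, X.ι_injective ?_, X.ι_injective ?_⟩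
  · rw [map_mul, hxg, hzg, map_one, ← Units.val_mul, mul_inv_cancel, Units.val_one]
  · rw [map_mul, hxg, hzg, map_one, ← Units.val_mul, inv_mul_cancel, Units.val_one]

/-- **The principal level-`q` group `Γ̄(q)`**: the elements of `ι(O₀'¹)` of the form `ι(x)` with `x ∈ O₀'`, `x ≡ 1 (mod q O₀')`.
[cite: KohenPacetti2016, §2 (arXiv:1403.7801v3 pp. 7–8)] -/
def principalLevel (X : CartanLevelCurveData D M C) (q : ℕ) : Subgroup (GL (Fin 2) ℝ) where
  carrier := {g | g ∈ coverUnits X q ∧ ∃ x ∈ coverOrder X q, X.ι x = (g : Matrix (Fin 2) (Fin 2) ℝ) ∧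
    ∃ y ∈ coverOrder X q, x - 1 = (q : ℤ) • y}
  one_mem' := ⟨(coverUnits X q).one_mem, 1, (isOrder_coverOrder X q).one_mem, by simp, 0, (coverOrder X q).zero_mem, by simp⟩
  mul_mem' := by
    rintro g g' ⟨hg, x, hx, hxg, y, hy, hxy⟩ ⟨hg', x', hx', hxg', y', hy', hxy'⟩
    have hO := isOrder_coverOrder X q
    refine ⟨(coverUnits X q).mul_mem hg hg', x * x', hO.mul_mem x hx x' hx', by rw [map_mul, hxg, hxg', Units.val_mul],
      y * x' + y', (coverOrder X q).add_mem (hO.mul_mem y hy x' hx') hy', ?_⟩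
    have e : x * x' - 1 = (x - 1) * x' + (x' - 1) := by rw [sub_mul, one_mul, sub_add_sub_cancel]
    rw [e, hxy, hxy', smul_mul_assoc, smul_add]
  inv_mem' := by
    rintro g ⟨hg, x, hx, hxg, y, hy, hxy⟩
    obtain ⟨x₁, hx₁, z, hz, hx₁g, hzg, hxz, hzx⟩ := exists_mul_eq_one_of_mem_coverUnits X q hg
    have hxx₁ : x = x₁ := X.ι_injective (by rw [hxg, hx₁g])
    subst hxx₁
    refine ⟨(coverUnits X q).inv_mem hg, z, hz, hzg, -(z * y), (coverOrder X q).neg_mem ((isOrder_coverOrder X q).mul_mem z hz y hy), ?_⟩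
    have e : z - 1 = -(z * (x - 1)) := by rw [mul_sub, mul_one, hzx, neg_sub]
    rw [e, hxy, mul_smul_comm, smul_neg]

/-- `Γ̄(q) ≤ ι(O₀'¹)`. -/
theorem principalLevel_le_coverUnits (X : CartanLevelCurveData D M C) (q : ℕ) : principalLevel X q ≤ coverUnits X q := fun _ hg => hg.1

/-- Membership in `Γ̄(q)` (definitional). -/
theorem mem_principalLevel_iff (X : CartanLevelCurveData D M C) (q : ℕ) {g : GL (Fin 2) ℝ} :
    g ∈ principalLevel X q ↔ g ∈ coverUnits X q ∧ ∃ x ∈ coverOrder X q, X.ι x = (g : Matrix (Fin 2) (Fin 2) ℝ) ∧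
      ∃ y ∈ coverOrder X q, x - 1 = (q : ℤ) • y :=
  Iff.rfl

/-- **`Γ̄(q) ≤ X.Gamma`** for `q ∈ C`: an element `x = 1 + q y` of `O₀'` lies in `X.O` since `q O₀' ⊆ X.O`. -/
theorem principalLevel_le_Gamma (X : CartanLevelCurveData D M C) (q : ℕ) (hq : q ∈ C) : principalLevel X q ≤ X.Gamma := by
  rintro g ⟨hg, x, hx, hxg, y, hy, hxy⟩
  obtain ⟨x₁, hx₁, z, hz, hx₁g, hzg, hxz, hzx⟩ := exists_mul_eq_one_of_mem_coverUnits X q hg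
  have hxx₁ : x = x₁ := X.ι_injective (by rw [hxg, hx₁g])
  subst hxx₁
  have hxO : x ∈ X.O := by
    have e : x = 1 + (q : ℤ) • y := by rw [← hxy]; abel
    rw [e]
    exact X.O.add_mem X.isOrder.one_mem (smul_mem_O_of_mem_coverOrder X q hq hy)
  have hzO : z ∈ X.O := by
    -- `z = 1 - z (x - 1) = 1 - q • (z y)`
    have e : z = 1 - (q : ℤ) • (z * y) := by
      have : z * (x - 1) = (q : ℤ) • (z * y) := by rw [hxy, mul_smul_comm]
      rw [← this, mul_sub, mul_one, hzx, sub_sub_cancel]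
    rw [e]
    exact X.O.sub_mem X.isOrder.one_mem (smul_mem_O_of_mem_coverOrder X q hq ((isOrder_coverOrder X q).mul_mem z hz y hy))
  exact ⟨⟨x, hxO, hx₁g⟩, ⟨z, hzO, hzg⟩, hg.2.2⟩

/-- **`Γ̄(q)` is NORMAL in `ι(O₀'¹)`**: `u (1 + q y) u⁻¹ = 1 + q (u y u⁻¹)`. -/
theorem conj_mem_principalLevel (X : CartanLevelCurveData D M C) (q : ℕ) {g h : GL (Fin 2) ℝ} (hg : g ∈ coverUnits X q) (hh : h ∈ principalLevel X q) :
    g * h * g⁻¹ ∈ principalLevel X q := by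
  obtain ⟨hh₀, x, hx, hxh, y, hy, hxy⟩ := hh
  obtain ⟨u, hu, v, hv, hug, hvg, huv, hvu⟩ := exists_mul_eq_one_of_mem_coverUnits X q hg
  have hO := isOrder_coverOrder X q
  refine ⟨(coverUnits X q).mul_mem ((coverUnits X q).mul_mem hg hh₀) ((coverUnits X q).inv_mem hg), u * x * v,
    hO.mul_mem _ (hO.mul_mem u hu x hx) v hv, by rw [map_mul, map_mul, hug, hxh, hvg, Units.val_mul, Units.val_mul],
    u * y * v, hO.mul_mem _ (hO.mul_mem u hu y hy) v hv, ?_⟩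
  have e : u * x * v - 1 = u * (x - 1) * v := by rw [mul_sub, sub_mul, mul_one, huv]
  rw [e, hxy, mul_smul_comm, smul_mul_assoc]

/-- The normality as an equality of conjugates: `g Γ̄(q) g⁻¹ = Γ̄(q)` for `g ∈ ι(O₀'¹)` (Mathlib's `ConjAct` form, as consumed by `CuspForm.translate`). -/
theorem conjAct_smul_principalLevel (X : CartanLevelCurveData D M C) (q : ℕ) {g : GL (Fin 2) ℝ} (hg : g ∈ coverUnits X q) :
    ConjAct.toConjAct g • principalLevel X q = principalLevel X q := by
  ext h
  rw [Subgroup.mem_pointwise_smul_iff_inv_smul_mem, ← ConjAct.toConjAct_inv, ConjAct.toConjAct_smul, inv_inv]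
  constructor
  · intro hh
    have h1 := conj_mem_principalLevel X q hg hh
    rwa [show g * (g⁻¹ * h * g) * g⁻¹ = h by group] at h1
  · intro hh
    have h1 := conj_mem_principalLevel X q ((coverUnits X q).inv_mem hg) hh
    rwa [inv_inv] at h1

/-! ## §3 The slash action of `ι(O₀'¹)` on `S₂(Γ̄(q))` (a `ℂ`-linear representation; `Γ̄(q)` acts trivially) -/

/-- `Γ̄(q) ≤ SL₂(ℝ)` (so that `CuspForm (principalLevel X q) k` is a `ℂ`-module). An instance on this file's own definition. -/
instance hasDetOne_principalLevel (X : CartanLevelCurveData D M C) (q : ℕ) : (principalLevel X q).HasDetOne :=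
  ⟨fun hg => hg.1.2.2⟩

/-- Elements of `ι(O₀'¹)` have positive determinant (`= 1`). -/
theorem det_pos_of_mem_coverUnits (X : CartanLevelCurveData D M C) (q : ℕ) {g : GL (Fin 2) ℝ} (hg : g ∈ coverUnits X q) :
    0 < g.det.val := by
  have h : g.det = 1 := hg.2.2
  rw [h, Units.val_one]; exact one_pos

/-- **`ρ(g) F := F ∣[2] g⁻¹`** for `g ∈ ι(O₀'¹)` and `F ∈ S₂(Γ̄(q))` — again a cusp form on `Γ̄(q)` because `g` normalises `Γ̄(q)`
(Mathlib `CuspForm.translate`, transported along `conjAct_smul_principalLevel`). [cite: KohenPacetti2016, §1.3 and §2 (arXiv:1403.7801v3 pp. 5–8)] -/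
def coverSlash (X : CartanLevelCurveData D M C) (q : ℕ) (g : coverUnits X q) (F : CuspForm (principalLevel X q) 2) :
    CuspForm (principalLevel X q) 2 :=
  (CuspForm.translate F ((g : GL (Fin 2) ℝ)⁻¹)).copy (⇑F ∣[(2 : ℤ)] ((g : GL (Fin 2) ℝ)⁻¹)) rfl
    (by rw [inv_inv]; exact (conjAct_smul_principalLevel X q g.2).symm)

/-- `ρ(g) F` as a function: `F ∣[2] g⁻¹`. -/
@[simp] theorem coe_coverSlash (X : CartanLevelCurveData D M C) (q : ℕ) (g : coverUnits X q) (F : CuspForm (principalLevel X q) 2) :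
    ⇑(coverSlash X q g F) = ⇑F ∣[(2 : ℤ)] ((g : GL (Fin 2) ℝ)⁻¹) := rfl

/-- `ρ(g)` is additive. -/
theorem coverSlash_add (X : CartanLevelCurveData D M C) (q : ℕ) (g : coverUnits X q) (F G : CuspForm (principalLevel X q) 2) :
    coverSlash X q g (F + G) = coverSlash X q g F + coverSlash X q g G := by
  apply CuspForm.ext; intro τ
  simp only [coe_coverSlash, CuspForm.coe_add, SlashAction.add_slash]

/-- `ρ(g)` is `ℂ`-homogeneous (`det g > 0`, so no complex conjugation intervenes in the slash). -/
theorem coverSlash_smul (X : CartanLevelCurveData D M C) (q : ℕ) (g : coverUnits X q) (c : ℂ) (F : CuspForm (principalLevel X q) 2) :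
    coverSlash X q g (c • F) = c • coverSlash X q g F := by
  apply CuspForm.ext; intro τ
  have hdet : 0 < ((g : GL (Fin 2) ℝ)⁻¹).det.val := by
    rw [map_inv, Units.val_inv_eq_inv_val]
    exact inv_pos.mpr (det_pos_of_mem_coverUnits X q g.2)
  have hσ : UpperHalfPlane.σ ((g : GL (Fin 2) ℝ)⁻¹) c = c := by
    simp only [UpperHalfPlane.σ, if_pos hdet]; rfl
  simp only [coe_coverSlash, CuspForm.IsGLPos.coe_smul, ModularForm.smul_slash, hσ]

/-- `ρ(1) = id`. -/
theorem coverSlash_one (X : CartanLevelCurveData D M C) (q : ℕ) (F : CuspForm (principalLevel X q) 2) :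
    coverSlash X q 1 F = F := by
  apply CuspForm.ext; intro τ
  simp only [coe_coverSlash, OneMemClass.coe_one, inv_one, SlashAction.slash_one]

/-- `ρ(g h) = ρ(g) ∘ ρ(h)` (a LEFT action, from the right slash action by `g⁻¹`). -/
theorem coverSlash_mul (X : CartanLevelCurveData D M C) (q : ℕ) (g h : coverUnits X q) (F : CuspForm (principalLevel X q) 2) :
    coverSlash X q (g * h) F = coverSlash X q g (coverSlash X q h F) := by
  apply CuspForm.ext; intro τ
  simp only [coe_coverSlash, Subgroup.coe_mul, mul_inv_rev, SlashAction.slash_mul]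

/-- `Γ̄(q)` acts trivially: for `g ∈ Γ̄(q)`, `ρ(g) F = F`. -/
theorem coverSlash_eq_self_of_mem (X : CartanLevelCurveData D M C) (q : ℕ) (g : coverUnits X q)
    (hg : (g : GL (Fin 2) ℝ) ∈ principalLevel X q) (F : CuspForm (principalLevel X q) 2) : coverSlash X q g F = F := by
  apply CuspForm.ext; intro τ
  rw [coe_coverSlash]
  exact congr_fun (SlashInvariantForm.slash_action_eqn F _ ((principalLevel X q).inv_mem hg)) τ

/-- **The representation of `ι(O₀'¹)` on `S₂(Γ̄(q))`** by `g ↦ (F ↦ F ∣[2] g⁻¹)`; it is trivial on `Γ̄(q)` (`coverSlash_eq_self_of_mem`), hence a representation of the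
finite quotient `ι(O₀'¹) ∕ Γ̄(q)` (`≅ SL₂(𝔽_q)` by strong approximation — a print fact NOT used here). [cite: KohenPacetti2016, §1.3 and §2 (arXiv:1403.7801v3 pp. 5–8)] -/
def coverRep (X : CartanLevelCurveData D M C) (q : ℕ) : Representation ℂ (coverUnits X q) (CuspForm (principalLevel X q) 2) where
  toFun g :=
    { toFun := coverSlash X q g
      map_add' := coverSlash_add X q g
      map_smul' := coverSlash_smul X q g }
  map_one' := by
    apply LinearMap.ext; intro F
    exact coverSlash_one X q F
  map_mul' g h := by
    apply LinearMap.ext; intro F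
    exact coverSlash_mul X q g h F

/-- `coverRep` unfolds to `coverSlash`. -/
@[simp] theorem coverRep_apply (X : CartanLevelCurveData D M C) (q : ℕ) (g : coverUnits X q) (F : CuspForm (principalLevel X q) 2) :
    coverRep X q g F = coverSlash X q g F := rfl

/-- `Γ̄(q)` lies in the kernel of `coverRep`. -/
theorem coverRep_eq_self_of_mem (X : CartanLevelCurveData D M C) (q : ℕ) (g : coverUnits X q)
    (hg : (g : GL (Fin 2) ℝ) ∈ principalLevel X q) (F : CuspForm (principalLevel X q) 2) : coverRep X q g F = F :=
  coverSlash_eq_self_of_mem X q g hg F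

end Summit.BirchSwinnertonDyer.BirchSwinnertonDyer.Theorems.CartanCover

end
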